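import Summits.QuantumFields.BalabanUV.T4Continuum.Support.NE7CornerBumpFlatGalerkin
import Summits.QuantumFields.BalabanUV.T4Continuum.Support.NE7CornerBumpFlatGalerkinSup
import Summits.QuantumFields.BalabanUV.T4Continuum.Support.NE3DiscreteGradientEstimate
import HarnessLib

/-!
# NE7CornerBumpFlatGalerkinLetters — F90's GALERKIN LETTER `hGalR` FOR THE BUMP CLASS AT THE FLAT BACKGROUND, COMPLETE: for every skew periodic source `F`
# there is `λ₁ ∈ T^ρ` with `F + Δ_1λ₁ ⊥ Δ_1T^ρ`, `‖Δ_1λ₁‖ ≤ c_R‖F‖` (`c_R = 2 + 576·16^d·64^{2(d−1)}`) AND `‖λ₁‖ ≤ 32d³N²·M²·c_R‖F‖` (torus-scale sup-regularity of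
# `Δ_1` + the smeared mean at the corner `0`); file 33

Cell `pub-balaban`, rung (B)+1 sub-cell t4, lineage `b2b-balaban-t4-ne7-p1` (CRUX PROVER NE7 #1 = OWNER of row NE7), generation 78; memo
`t4/b2b-balaban-t4-ne7-p1-g78/BUMP-CLASS-FLAT.md` §4.  File F102 (over F100 `NE7CornerBumpFlatGalerkin` (existence, `λ₁ ∈ T^ρ`), F101 `NE7CornerBumpFlatGalerkinSup`
(`‖Δ_1λ₁‖ ≤ c_R‖F‖`), row NE3's lattice maximum principle `NE3DiscreteGradientEstimate.supRegularity_of_blockMeanZero` with ONE block = the whole torus).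
WHY (memo §4).  F90's `hGalR` wants, besides `‖Δλ₁‖ ≤ c_R B`, the size `‖λ₁‖ ≤ c₀M²c_R B`.  For `λ₁` in the bump class the only normalisation is clause (ii) (the
`ρ`-smeared mean at the corner `0` vanishes), so the natural scale is the TORUS `(N·M)²`: `u := λ₁ − mean λ₁` has zero mean, hence `‖u‖ ≤ 16d³(NM)²‖Δ_1λ₁‖` by row NE3's
maximum principle on the single block `[0, NM)^d`; and `(Σρ)•mean λ₁ = −Σ_r ρ(r)•u(r − s)` (clause (ii)), so `‖mean λ₁‖ ≤ sup‖u‖`.  Net: `c₀ = 32d³N²` (the `N²` is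
the torus∕block scale ratio; the torus size `N` is fixed on rung (B)+1).
WHAT ([folklore]; 0 def, 0 sorry; class by the equational hypothesis `hT` as in F96–F101).  **`galerkin_letters_flatCfg_bump`** — F90's `hGalR` at `W = flatCfg` for the
bump class with `c_R = 2 + 576·16^d·64^{2(d−1)}`, `c₀ = 32d³N²` (`M ≥ 8`, `N ≥ 1`, `d ≥ 1`).
HONEST FRAMING (page 1): lattice analysis at the TRIVIAL background; the docking into F89∕F90 is file 34; the curved letters, (L1)′, α₁, (L2) are NOT here; nothing of Bałaban's
asserted; (APE) NOT proved; NOT ONE-STEP, NOT NE7; spine 0∕9; finite T⁴ rung (B)+1 — NOT infinite volume, NOT mass gap, NOT `BetaPertH`, NOT Clay.  Continuum YM on T⁴ ⇐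
BetaPertH ∧ nine spine estimates (0/9 proved); BetaPertH ⇐ (D1) ∧ (D4) ∧ CAP+tail; G-an2-4 gates asym, D1 and NE2/3/4.
-/

set_option autoImplicit false

open scoped BigOperators Matrix Matrix.Norms.L2Operator
open NormedSpace Finset

namespace Summit.QuantumFields.BalabanUV.T4Continuum.NE7CornerBumpFlatGalerkinLetters

open Literature.MathematicalPhysics.QuantumFieldTheory.Balaban1983to89
open B7Prop1Explicit B7Prop2Explicit MatrixNorms
open T4AveragingDeficitWallBoundary (periodBox mem_periodBox card_periodBox)
open MinimalActionWitness (flatCfg)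
open SmoothRefineBlocks (blk res)
open NE3CovariantCalculus (hsR hsR_self)
open NE3FrameFreeDecompositionPrep (hsR_smul_right)
open NE3LandauOrbit (hsR_zero_left eq_zero_of_nhsNormSq_eq_zero)
open NE3.PairLandauB8 (covLapSite)
open NE3.LandauCorrectionSupB8FlatH0 (covLapSite_flatCfg_eq_neg_laplacian)
open NE3DiscreteGradientEstimate (supRegularity_of_blockMeanZero)
open PeriodicChoice (periodic_vec)
open NE7PinnedLandauLettersOfLHCI (covLapSite_sub')
open NE7ProfileFieldFlat (sum_hsR_profS)
open NE7CornerBumpFlatLHCI (rho_nonneg covLapSite_flatCfg_const)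
open NE7CornerBumpFlatProjection (eq_zero_of_mem_periodBox_of_dvd dvd_add_period_iff sum_rho_pos)
open NE7CornerBumpFlatGalerkin (galerkin_site_flatCfg_bump)
open NE7CornerBumpFlatGalerkinSup (galerkin_residual_sup_flatCfg_bump)

noncomputable section

variable {d : ℕ} {n : Type*} [Fintype n] [DecidableEq n]

/-- **F90's `hGalR` AT `W = 1` FOR THE BUMP CLASS, COMPLETE** (statement in the module docstring). [folklore] -/
theorem galerkin_letters_flatCfg_bump [Nonempty n] (hd : 1 ≤ d) {M N : ℕ} (hM : 8 ≤ M) (hN : 1 ≤ N) {ψ : ℤ → ℝ}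
    (hψ : ∀ t : ℤ, ψ t = if 2 ≤ t ∧ t ≤ (M : ℤ) - 2 then (((t : ℝ) - 2) * ((M : ℝ) - 2 - t)) ^ 2 else 0)
    {ρ : Site d → ℝ} (hρ : ∀ r, ρ r = ∏ i, ψ (r i)) {s : Site d} (hs : s = fun _ => ((M / 2 : ℕ) : ℤ))
    (T : (Site d → Matrix n n ℂ) → Prop)
    (hT : ∀ nu : Site d → Matrix n n ℂ, T nu ↔
      ((∀ C : Site d → Matrix n n ℂ, (∀ w, C w ∈ skewAdjoint (Matrix n n ℂ)) → (∀ (w : Site d) (i : Fin d), C (w + (N : ℤ) • e i) = C w) →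
          (∀ w : Site d, C ((N : ℤ) • w) = 0) →
          ∑ y ∈ periodBox (d := d) (N * M), hsR ((fun x => ρ (res M (x + s)) • C (blk M (x + s))) y)
            (covLapSite (flatCfg (d := d) (n := n)) (covLapSite (flatCfg (d := d) (n := n)) nu) y) = 0) ∧
       (∀ C : Site d → Matrix n n ℂ, (∀ w, C w ∈ skewAdjoint (Matrix n n ℂ)) → (∀ (w : Site d) (i : Fin d), C (w + (N : ℤ) • e i) = C w) →
          (∀ w : Site d, (¬ ∀ i, (N : ℤ) ∣ w i) → C w = 0) →
          ∑ y ∈ periodBox (d := d) (N * M), hsR ((fun x => ρ (res M (x + s)) • C (blk M (x + s))) y) (nu y) = 0))) :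
    ∀ F : Site d → Matrix n n ℂ, (∀ y, F y ∈ skewAdjoint (Matrix n n ℂ)) →
      (∀ (y : Site d) (i : Fin d), F (y + ((N * M : ℕ) : ℤ) • e i) = F y) →
      ∃ lam₁ : Site d → Matrix n n ℂ,
        (∀ y, lam₁ y ∈ skewAdjoint (Matrix n n ℂ)) ∧ (∀ (y : Site d) (i : Fin d), lam₁ (y + ((N * M : ℕ) : ℤ) • e i) = lam₁ y) ∧
        (∀ nu : Site d → Matrix n n ℂ, (∀ y, nu y ∈ skewAdjoint (Matrix n n ℂ)) →
            (∀ (y : Site d) (i : Fin d), nu (y + ((N * M : ℕ) : ℤ) • e i) = nu y) → T nu →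
          ∑ y ∈ periodBox (d := d) (N * M), hsR (F y + covLapSite (flatCfg (d := d) (n := n)) lam₁ y) (covLapSite (flatCfg (d := d) (n := n)) nu y) = 0) ∧
        ∀ B : ℝ, (∀ y, ‖F y‖ ≤ B) →
          (∀ y, ‖covLapSite (flatCfg (d := d) (n := n)) lam₁ y‖ ≤ (2 + 576 * (16 : ℝ) ^ d * (64 : ℝ) ^ (2 * (d - 1))) * B) ∧
          (∀ y, ‖lam₁ y‖ ≤ (32 * (d : ℝ) ^ 3 * (N : ℝ) ^ 2) * (M : ℝ) ^ 2 * ((2 + 576 * (16 : ℝ) ^ d * (64 : ℝ) ^ (2 * (d - 1))) * B)) := by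
  classical
  intro F hFs hFP
  have hM1 : 1 ≤ M := by omega
  have hP : 1 ≤ N * M := Nat.mul_pos (by omega) (by omega)
  obtain ⟨lam₁, hls, hlP, hlT, horth⟩ := galerkin_site_flatCfg_bump hM hN hψ hρ s T hT F
  refine ⟨lam₁, hls, hlP, horth, fun B hB => ?_⟩
  have hΔ : ∀ y, ‖covLapSite (flatCfg (d := d) (n := n)) lam₁ y‖ ≤ (2 + 576 * (16 : ℝ) ^ d * (64 : ℝ) ^ (2 * (d - 1))) * B :=
    galerkin_residual_sup_flatCfg_bump hd hM hN hψ hρ hs T hT hFs hFP hB hls hlP hlT horth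
  refine ⟨hΔ, ?_⟩
  set cRB : ℝ := (2 + 576 * (16 : ℝ) ^ d * (64 : ℝ) ^ (2 * (d - 1))) * B with hcRB
  have hcRB0 : 0 ≤ cRB := (norm_nonneg _).trans (hΔ 0)
  -- `u := λ₁ − mean λ₁` on the single block `[0, NM)^d`
  set Pn : ℕ := N * M with hPn
  set m : Matrix n n ℂ := (((Pn : ℝ) ^ d)⁻¹) • ∑ y ∈ periodBox (d := d) Pn, lam₁ y with hm
  set u : Site d → Matrix n n ℂ := fun y => lam₁ y - m with hu
  have hPd : (0 : ℝ) < (Pn : ℝ) ^ d := by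
    have : (0 : ℝ) < Pn := by exact_mod_cast (by omega : 0 < N * M)
    positivity
  have huP : ∀ (x : Site d) (τ : Fin d), u (x + ((1 * Pn : ℕ) : ℤ) • e τ) = u x := fun x τ => by
    simp only [hu, one_mul]; rw [hlP x τ]
  have huP' : ∀ (x : Site d) (τ : Fin d), u (x + (Pn : ℤ) • e τ) = u x := fun x τ => by simpa using huP x τ
  have hsumu : ∑ v ∈ periodBox (d := d) Pn, u v = 0 := by
    simp only [hu, Finset.sum_sub_distrib, Finset.sum_const, card_periodBox]
    rw [← Nat.cast_smul_eq_nsmul ℝ, hm, smul_smul]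
    push_cast
    rw [mul_inv_cancel₀ hPd.ne', one_smul, sub_self]
  have hmean : ∀ z : Site d, ∑ v ∈ periodBox (d := d) Pn, u ((Pn : ℤ) • z + v) = 0 := by
    intro z
    rw [Finset.sum_congr rfl fun v _ => by rw [add_comm, periodic_vec huP' v z]]
    exact hsumu
  have hB' : ∀ x : Site d, ‖∑ i, ((u (x + e i) - u x) - (u x - u (x - e i)))‖ ≤ cRB := by
    intro x
    have e1 : ∑ i, ((u (x + e i) - u x) - (u x - u (x - e i))) = -covLapSite (flatCfg (d := d) (n := n)) u x := by
      rw [covLapSite_flatCfg_eq_neg_laplacian, neg_neg]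
    have e2 : covLapSite (flatCfg (d := d) (n := n)) u x = covLapSite (flatCfg (d := d) (n := n)) lam₁ x := by
      rw [hu, covLapSite_sub' _ lam₁ (fun _ => m) x, covLapSite_flatCfg_const, sub_zero]
    rw [e1, norm_neg, e2]; exact hΔ x
  have hureg := (supRegularity_of_blockMeanZero hd (M := Pn) (N := 1) hP le_rfl u huP hmean hB').2
  -- the smeared mean at the corner `0` vanishes (clause (ii) for `λ₁`)
  have hSρ : ∑ r ∈ periodBox (d := d) M, ρ r • lam₁ ((M : ℤ) • (0 : Site d) + r - s) = 0 := by
    set Sρ : Matrix n n ℂ := ∑ r ∈ periodBox (d := d) M, ρ r • lam₁ ((M : ℤ) • (0 : Site d) + r - s) with hSρdef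
    have hSρs : Sρ ∈ skewAdjoint (Matrix n n ℂ) := (skewAdjoint _).sum_mem fun r _ => skewAdjoint.smul_mem _ (hls _)
    set C : Site d → Matrix n n ℂ := fun w => if (∀ i, (N : ℤ) ∣ w i) then Sρ else 0 with hC
    have hCs : ∀ w, C w ∈ skewAdjoint (Matrix n n ℂ) := fun w => by
      simp only [hC]; split_ifs
      · exact hSρs
      · exact (skewAdjoint _).zero_mem
    have hCP : ∀ (w : Site d) (i : Fin d), C (w + (N : ℤ) • e i) = C w := fun w i => by simp only [hC, dvd_add_period_iff w i]
    have hC0 : ∀ w : Site d, (¬ ∀ i, (N : ℤ) ∣ w i) → C w = 0 := fun w hw => by simp only [hC, if_neg hw]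
    have h1 := ((hT lam₁).mp hlT).2 C hCs hCP hC0
    have e := sum_hsR_profS hM1 hN s ρ C hlP hCP
    simp only at e
    rw [e] at h1
    have hin : ∀ w ∈ periodBox (d := d) N, hsR (C w) (∑ r ∈ periodBox (d := d) M, ρ r • lam₁ ((M : ℤ) • w + r - s))
        = if w = 0 then nhsNormSq Sρ else 0 := by
      intro w hw
      split_ifs with hw0
      · subst hw0
        simp only [hC]; rw [if_pos fun i => by simp, ← hSρdef, hsR_self]
      · have hw' : ¬ ∀ i, (N : ℤ) ∣ w i := fun hd' => hw0 (eq_zero_of_mem_periodBox_of_dvd hw hd')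
        rw [hC0 w hw', hsR_zero_left]
    rw [Finset.sum_congr rfl hin, Finset.sum_ite_eq' (periodBox (d := d) N) (0 : Site d), if_pos] at h1
    swap
    · exact mem_periodBox.mpr fun _ => ⟨le_rfl, by simp only [Pi.zero_apply]; exact_mod_cast (by omega : 0 < N)⟩
    exact eq_zero_of_nhsNormSq_eq_zero h1
  -- the mean is bounded by `sup ‖u‖`
  have hρsum := sum_rho_pos (d := d) hM hψ hρ
  have hm_le : ‖m‖ ≤ 16 * (d : ℝ) ^ 3 * (Pn : ℝ) ^ 2 * cRB := by
    have e1 : (∑ r ∈ periodBox (d := d) M, ρ r) • m = -∑ r ∈ periodBox (d := d) M, ρ r • u ((M : ℤ) • (0 : Site d) + r - s) := by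
      rw [Finset.sum_smul, ← sub_eq_zero, sub_neg_eq_add, ← Finset.sum_add_distrib]
      rw [← hSρ]
      refine Finset.sum_congr rfl fun r _ => ?_
      rw [hu]; simp only; rw [smul_sub, add_sub_cancel]
    have e2 : ‖(∑ r ∈ periodBox (d := d) M, ρ r) • m‖ ≤ (∑ r ∈ periodBox (d := d) M, ρ r) * (16 * (d : ℝ) ^ 3 * (Pn : ℝ) ^ 2 * cRB) := by
      rw [e1, norm_neg]
      calc ‖∑ r ∈ periodBox (d := d) M, ρ r • u ((M : ℤ) • (0 : Site d) + r - s)‖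
          ≤ ∑ r ∈ periodBox (d := d) M, ‖ρ r • u ((M : ℤ) • (0 : Site d) + r - s)‖ := norm_sum_le _ _
        _ ≤ ∑ r ∈ periodBox (d := d) M, ρ r * (16 * (d : ℝ) ^ 3 * (Pn : ℝ) ^ 2 * cRB) := Finset.sum_le_sum fun r _ => by
            rw [norm_smul, Real.norm_eq_abs, abs_of_nonneg (rho_nonneg hψ hρ r)]
            exact mul_le_mul_of_nonneg_left (hureg _) (rho_nonneg hψ hρ r)
        _ = (∑ r ∈ periodBox (d := d) M, ρ r) * (16 * (d : ℝ) ^ 3 * (Pn : ℝ) ^ 2 * cRB) := by rw [Finset.sum_mul]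
    rw [norm_smul, Real.norm_eq_abs, abs_of_pos hρsum] at e2
    exact le_of_mul_le_mul_left e2 hρsum
  -- assemble
  intro y
  have hPn2 : (Pn : ℝ) ^ 2 = (N : ℝ) ^ 2 * (M : ℝ) ^ 2 := by rw [hPn]; push_cast; ring
  have e : lam₁ y = u y + m := by simp only [hu, sub_add_cancel]
  rw [e]
  calc ‖u y + m‖ ≤ ‖u y‖ + ‖m‖ := norm_add_le _ _
    _ ≤ 16 * (d : ℝ) ^ 3 * (Pn : ℝ) ^ 2 * cRB + 16 * (d : ℝ) ^ 3 * (Pn : ℝ) ^ 2 * cRB := add_le_add (hureg y) hm_le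
    _ = (32 * (d : ℝ) ^ 3 * (N : ℝ) ^ 2) * (M : ℝ) ^ 2 * cRB := by rw [hPn2]; ring

end

end Summit.QuantumFields.BalabanUV.T4Continuum.NE7CornerBumpFlatGalerkinLetters
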